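import Summits.ABC.IUTFork.Joshi.TestDictionaryCalibrationPlaces
import HarnessLib

/-!
# Branch E TEST vs S — the calibration across places, III: the place obstruction SURVIVES print-like indeterminacies

Record file of the abc-iut cell, branch E (rung LADDER-ABC:A2.E; seat abc-iut-E-t42 gen 2, row T-42d, AUTHORS-FIRST sequel of
`Joshi/TestDictionaryCalibrationPlaces.lean` p438822 / `…PlacesModel.lean` p439174). **No side is taken** on [IUTchIII] Cor. 3.12 or on
any author (Mochizuki / Scholze–Stix / Joshi); typed ≠ proved; interface/toy level; located, not adjudicated.

THE OBJECTION ANSWERED. Part 1's obstruction `TwoPlace.not_indPlaceSeparable` used RIGID shells (strip-automorphisms and Ism reduced to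
the identity), where `⟨(Ind1) ∪ (Ind2)⟩` is literally the group of diagonal capsule permutations. The cell's frozen-print instantiations
are NOT rigid: Ism = {±1} at the nonarchimedean place ([IUTchIII] Prop. 1.2 (vi) «Ism»; abc-iut-w5-d247's `signShells`; R17). Does a
non-trivial (Ind2) rescue place-separability — can signs at one place emulate what only a capsule permutation does at another?

ANSWER (kernel; no `Prop` fact, no `sorry`): NO, for every DIAGONAL choice. Over part 1's two-place index `TwoPlace.index`, let
`diagShells A I` have carriers `log(𝒟⊢_v) := ℚ²`, strip-automorphisms `A v` and Ism `I v` — ANY sets of automorphisms containing the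
identity whose elements are DIAGONAL (`IsDiag`: each coordinate line `ℚ·e₀`, `ℚ·e₁` is preserved; e.g. `{1}`, the scalar signs `{±1}`,
coordinatewise signs, all diagonal units).
* §1 `IsDiag`, `diagShells`; the PATTERN TENSORS `tS S = ⊗_k (e₀ if k ∈ S else e₁)` (`S ⊆ S^±_{j+1}`) and their DETECTORS `detS S`
  (`detS_tS`: `detS S (tS S') = 1` if `S = S'`, else `0`).
* §2 **`exists_tracks_of_mem_closure`** (closure induction — an INVARIANT, not a structure theorem): every `Φ ∈ ⟨(Ind1) ∪ (Ind2)⟩`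
  TRACKS the patterns, `Φ_{j,v_ℚ} · t_S = c · t_{σ_j(S)}` with `c ≠ 0` and ONE capsule permutation `σ_j` for ALL places `v_ℚ`
  ((Ind2) and the strip part of (Ind1) only rescale the patterns, `diag_rescales_tS`; (Ind1)'s permutation is diagonal across places).
* §3 **`not_indPlaceSeparable_diagShells`**: the family «identity at `v_ℚ⁰`, swap of the factors `0, j` at `v_ℚ¹`» is assembled place by
  place from members and is not a member — for EVERY diagonal `A`, `I`; corollaries `not_indPlaceSeparable_signShells₂` (Ism =
  strip-automorphisms = {±1}, the frozen-print type) and part 1's rigid case re-derived (`not_indPlaceSeparable_rigid₂`).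
So the packet-locality of S located in parts 1–2 is not an artefact of rigidity: with print-like sign indeterminacies the ONE-indeterminacy
lines (X-01 / IndTranslate) remain strictly stronger than S across places, the excess being (Ind1)'s «one permutation of `S^±_{j+1}` for
all `v_ℚ`» ([IUTchIII] Thm. 3.11 (i) p. 154; `LogShells.Ind1`). What WOULD rescue separability is an Ism mixing the coordinate lines so
as to realise capsule permutations placewise — not the printed `{±1}`. [claim: Mochizuki2012, status: disputed]
[claim: Joshi2024ATS3, status: disputed] [cite: ScholzeStix2018, §2.2 pp. 9–10]
-/

noncomputable section

open Set

namespace Summit.ABC.IUTFork.Joshi.TwoPlace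

open Thm311 Cor312 Cor312Vol Literature.IUT.LogThetaLattice

/-! ## 1. Diagonal shells over the two-place index; pattern tensors and their detectors -/

/-- A DIAGONAL automorphism of `ℚ²`: it preserves both coordinate lines (`g·e_c = a·e_c`). The identity, the scalar signs `{±1}`
(print's nonarchimedean Ism as instantiated in the cell's `signShells`), coordinatewise signs and all diagonal units are diagonal.
TEST SHAPE on the signature, never asserted; no author claims it. [claim: Mochizuki2012, status: disputed] -/
@[claim "Mochizuki2012" "disputed"]
def IsDiag (g : (Fin 2 → ℚ) ≃ₗ[ℚ] (Fin 2 → ℚ)) : Prop := ∀ c : Fin 2, ∃ a : ℚ, g (Pi.single c 1) = a • Pi.single c 1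

/-- The identity is diagonal. [folklore] -/
theorem isDiag_refl : IsDiag (LinearEquiv.refl ℚ _) := fun c => ⟨1, by simp⟩

/-- The sign `−1` is diagonal. [folklore] -/
theorem isDiag_neg : IsDiag (LinearEquiv.neg ℚ (M := Fin 2 → ℚ)) := fun c =>
  ⟨-1, by rw [LinearEquiv.neg_apply, neg_one_smul]⟩

/-- A diagonal automorphism rescales each basis vector by a NONZERO scalar. [folklore] -/
theorem IsDiag.exists_ne_zero {g : (Fin 2 → ℚ) ≃ₗ[ℚ] (Fin 2 → ℚ)} (hg : IsDiag g) (c : Fin 2) :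
    ∃ a : ℚ, a ≠ 0 ∧ g (Pi.single c 1) = a • Pi.single c 1 := by
  obtain ⟨a, ha⟩ := hg c
  refine ⟨a, fun h0 => ?_, ha⟩
  rw [h0, zero_smul] at ha
  have h1 : (Pi.single c (1 : ℚ) : Fin 2 → ℚ) = 0 := g.injective (ha.trans (map_zero g).symm)
  have h2 : (1 : ℚ) = 0 := by simpa using congrFun h1 c
  exact one_ne_zero h2

/-- **Diagonal shells over the two-place index**: carriers `log(𝒟⊢_v) := ℚ²`, the log-shell all of it, strip-automorphisms `A v` and
Ism `I v` ANY sets containing the identity (diagonality is assumed in the theorems, not built in). [folklore] -/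
def diagShells (A I : index.V → Set ((Fin 2 → ℚ) ≃ₗ[ℚ] (Fin 2 → ℚ)))
    (hA : ∀ v, LinearEquiv.refl ℚ _ ∈ A v) (hI : ∀ v, LinearEquiv.refl ℚ _ ∈ I v) : LogShells index where
  carrier := fun _ => Fin 2 → ℚ
  shell := fun _ => Set.univ
  stripAut := A
  ism := I
  one_mem_stripAut := hA
  one_mem_ism := hI

section Patterns

variable (A I : index.V → Set ((Fin 2 → ℚ) ≃ₗ[ℚ] (Fin 2 → ℚ)))
  (hA : ∀ v, LinearEquiv.refl ℚ _ ∈ A v) (hI : ∀ v, LinearEquiv.refl ℚ _ ∈ I v)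

/-- The fibre over a place is the singleton `{pt v_ℚ}`. [folklore] -/
theorem fibre_eq_pt {vQ : index.VQ} (v : index.Fibre vQ) : v = pt vQ := Subtype.ext v.2

/-- The basis vector `e_c` of the 1-tensor packet. [folklore] -/
def Ec (vQ : index.VQ) (c : Fin 2) : (diagShells A I hA hI).Packet1 vQ := fun _ => Pi.single c 1

/-- The factors of the PATTERN TENSOR of `S ⊆ S^±_{j+1}`: `e₀` on the factors in `S`, `e₁` elsewhere. [folklore] -/
def xS {j : index.Label} (vQ : index.VQ) (S : Finset (index.Caps j)) : index.Caps j → (diagShells A I hA hI).Packet1 vQ :=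
  fun k => if k ∈ S then Ec A I hA hI vQ 0 else Ec A I hA hI vQ 1

/-- **The pattern tensor `t_S := ⊗_k (e₀ if k ∈ S else e₁)`.** [folklore] -/
def tS {j : index.Label} (vQ : index.VQ) (S : Finset (index.Caps j)) : (diagShells A I hA hI).Packet j vQ :=
  (diagShells A I hA hI).tprod j vQ (xS A I hA hI vQ S)

/-- The image of a pattern under a capsule permutation: `σ(S)`. [folklore] -/
def permS {j : index.Label} (σ : Equiv.Perm (index.Caps j)) (S : Finset (index.Caps j)) : Finset (index.Caps j) :=
  S.map σ.toEmbedding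

/-- Membership in `σ(S)`. [folklore] -/
theorem mem_permS {j : index.Label} (σ : Equiv.Perm (index.Caps j)) (S : Finset (index.Caps j)) (k : index.Caps j) :
    k ∈ permS σ S ↔ σ.symm k ∈ S := Finset.mem_map_equiv

/-- `1(S) = S`. [folklore] -/
theorem permS_one {j : index.Label} (S : Finset (index.Caps j)) : permS 1 S = S := by
  ext k; rw [mem_permS]; rfl

/-- `(σ τ)(S) = σ(τ(S))`. [folklore] -/
theorem permS_mul {j : index.Label} (σ τ : Equiv.Perm (index.Caps j)) (S : Finset (index.Caps j)) :
    permS (σ * τ) S = permS σ (permS τ S) := by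
  ext k; simp only [mem_permS, Equiv.Perm.mul_def, Equiv.symm_trans_apply]

/-- **Capsule permutations permute the patterns**: `permute σ · t_S = t_{σ(S)}`. [folklore] -/
theorem permute_tS {j : index.Label} (vQ : index.VQ) (σ : Equiv.Perm (index.Caps j)) (S : Finset (index.Caps j)) :
    (diagShells A I hA hI).permute j vQ σ (tS A I hA hI vQ S) = tS A I hA hI vQ (permS σ S) := by
  unfold tS
  rw [LogShells.permute_tprod]
  congr 1
  funext k
  simp only [xS, mem_permS]

/-- **Diagonal factor/summand automorphisms RESCALE the patterns**: `(⊗_k ⊕_v g_{k,v}) · t_S = c · t_S`, `c ≠ 0`. [folklore] -/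
theorem diag_rescales_tS {j : index.Label} (vQ : index.VQ)
    (g : index.Caps j → ∀ v : index.Fibre vQ, (Fin 2 → ℚ) ≃ₗ[ℚ] (Fin 2 → ℚ)) (hg : ∀ k v, IsDiag (g k v))
    (S : Finset (index.Caps j)) :
    ∃ c : ℚ, c ≠ 0 ∧ (diagShells A I hA hI).factorwise j vQ (fun k => (diagShells A I hA hI).summandwise vQ (g k))
      (tS A I hA hI vQ S) = c • tS A I hA hI vQ S := by
  choose a ha0 ha using fun k (c : Fin 2) => (hg k (pt vQ)).exists_ne_zero c
  let cS : index.Caps j → ℚ := fun k => if k ∈ S then a k 0 else a k 1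
  refine ⟨∏ k, cS k, Finset.prod_ne_zero_iff.2 fun k _ => by
    by_cases hk : k ∈ S <;> simp only [cS, hk, if_true, if_false] <;> exact ha0 k _, ?_⟩
  unfold tS
  erw [LogShells.factorwise_summandwise_tprod]
  have hx : (fun k => fun v : index.Fibre vQ => g k v (xS A I hA hI vQ S k v) : index.Caps j → (diagShells A I hA hI).Packet1 vQ) =
      fun k => cS k • xS A I hA hI vQ S k := by
    funext k v
    rw [fibre_eq_pt v]
    by_cases hk : k ∈ S
    · simp only [xS, Ec, hk, if_true, cS]; exact ha k 0
    · simp only [xS, Ec, hk, if_false, cS]; exact ha k 1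
  exact (congrArg ((diagShells A I hA hI).tprod j vQ) hx).trans
    (MultilinearMap.map_smul_univ (PiTensorProduct.tprod ℚ) cS (xS A I hA hI vQ S))

/-- The coordinate functional of the pattern `S` on factor `k`: coordinate `0` if `k ∈ S`, coordinate `1` otherwise. [folklore] -/
def coordS {j : index.Label} (vQ : index.VQ) (S : Finset (index.Caps j)) (k : index.Caps j) :
    (diagShells A I hA hI).Packet1 vQ →ₗ[ℚ] ℚ :=
  (LinearMap.proj (if k ∈ S then (0 : Fin 2) else 1) : (Fin 2 → ℚ) →ₗ[ℚ] ℚ) ∘ₗ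
    (LinearMap.proj (pt vQ) : (diagShells A I hA hI).Packet1 vQ →ₗ[ℚ] (Fin 2 → ℚ))

/-- **The DETECTOR of the pattern `S`**: `⊗_k y_k ↦ ∏_k coordS_k(y_k)`. [folklore] -/
def detS {j : index.Label} (vQ : index.VQ) (S : Finset (index.Caps j)) : (diagShells A I hA hI).Packet j vQ →ₗ[ℚ] ℚ :=
  (PiTensorProduct.constantBaseRingEquiv (index.Caps j) ℚ).toLinearEquiv.toLinearMap ∘ₗ
    PiTensorProduct.map fun k : index.Caps j => coordS A I hA hI vQ S k

/-- The detector on a pure tensor. [folklore] -/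
theorem detS_tprod {j : index.Label} (vQ : index.VQ) (S : Finset (index.Caps j))
    (x : index.Caps j → (diagShells A I hA hI).Packet1 vQ) :
    detS A I hA hI vQ S ((diagShells A I hA hI).tprod j vQ x) = ∏ k, x k (pt vQ) (if k ∈ S then 0 else 1) := by
  unfold detS LogShells.tprod
  rw [LinearMap.comp_apply]
  erw [PiTensorProduct.map_tprod]
  change (PiTensorProduct.constantBaseRingEquiv (index.Caps j) ℚ)
      (PiTensorProduct.tprod ℚ fun k : index.Caps j => coordS A I hA hI vQ S k (x k)) = _
  rw [PiTensorProduct.constantBaseRingEquiv_tprod]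
  rfl

/-- **The detector of `S` reads `1` on `t_S`.** [folklore] -/
theorem detS_tS_self {j : index.Label} (vQ : index.VQ) (S : Finset (index.Caps j)) :
    detS A I hA hI vQ S (tS A I hA hI vQ S) = 1 := by
  unfold tS
  rw [detS_tprod]
  refine Finset.prod_eq_one fun k _ => ?_
  by_cases hk : k ∈ S <;> simp [xS, Ec, hk]

/-- **The detector of `S` reads `0` on every OTHER pattern `t_{S'}`, `S' ≠ S`.** [folklore] -/
theorem detS_tS_of_ne {j : index.Label} (vQ : index.VQ) {S S' : Finset (index.Caps j)} (h : S' ≠ S) :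
    detS A I hA hI vQ S (tS A I hA hI vQ S') = 0 := by
  unfold tS
  rw [detS_tprod]
  obtain ⟨k, hk⟩ : ∃ k, ¬ (k ∈ S' ↔ k ∈ S) := not_forall.1 (mt Finset.ext_iff.2 h)
  refine Finset.prod_eq_zero (Finset.mem_univ k) ?_
  by_cases h1 : k ∈ S' <;> by_cases h2 : k ∈ S <;> simp_all [xS, Ec]

/-- Consequently `c · t_{S'} = t_S` forces `S' = S` (apply the detector of `S`). [folklore] -/
theorem eq_of_smul_tS_eq {j : index.Label} (vQ : index.VQ) {S S' : Finset (index.Caps j)} {c : ℚ}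
    (h : c • tS A I hA hI vQ S' = tS A I hA hI vQ S) : S' = S := by
  by_contra hne
  have h1 := congrArg (detS A I hA hI vQ S) h
  rw [map_smul, detS_tS_of_ne A I hA hI vQ hne, detS_tS_self, smul_zero] at h1
  exact zero_ne_one h1

end Patterns

/-! ## 2. Every element of `⟨(Ind1) ∪ (Ind2)⟩` tracks the patterns with ONE capsule permutation for all places -/

section Tracking

variable {A I : index.V → Set ((Fin 2 → ℚ) ≃ₗ[ℚ] (Fin 2 → ℚ))}
  {hA : ∀ v, LinearEquiv.refl ℚ _ ∈ A v} {hI : ∀ v, LinearEquiv.refl ℚ _ ∈ I v}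

/-- `Φ` TRACKS the patterns along `σ = (σ_j)_j`: `Φ_{j,v_ℚ} · t_S = c · t_{σ_j(S)}` with `c ≠ 0` — the SAME `σ_j` at every place.
INVARIANT of the closure induction (a Prop on the signature's automorphism families, never asserted; no author claims it).
[claim: Mochizuki2012, status: disputed] -/
@[claim "Mochizuki2012" "disputed"]
def Tracks (Φ : (diagShells A I hA hI).PacketAut) (σ : ∀ j : index.Label, Equiv.Perm (index.Caps j)) : Prop :=
  ∀ (j : index.Label) (vQ : index.VQ) (S : Finset (index.Caps j)),
    ∃ c : ℚ, c ≠ 0 ∧ Φ j vQ (tS A I hA hI vQ S) = c • tS A I hA hI vQ (permS (σ j) S)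

/-- The identity tracks along `1`. [folklore] -/
theorem tracks_one : Tracks (1 : (diagShells A I hA hI).PacketAut) 1 := fun j vQ S =>
  ⟨1, one_ne_zero, by rw [one_smul, Pi.one_apply, Pi.one_apply, Pi.one_apply, permS_one]; rfl⟩

/-- Products track along products. [folklore] -/
theorem Tracks.mul {Φ Ψ : (diagShells A I hA hI).PacketAut} {σ τ : ∀ j : index.Label, Equiv.Perm (index.Caps j)}
    (hΦ : Tracks Φ σ) (hΨ : Tracks Ψ τ) : Tracks (Φ * Ψ) (σ * τ) := fun j vQ S => by
  obtain ⟨d, hd, hdS⟩ := hΨ j vQ S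
  obtain ⟨c, hc, hcS⟩ := hΦ j vQ (permS (τ j) S)
  refine ⟨d * c, mul_ne_zero hd hc, ?_⟩
  rw [Pi.mul_apply, Pi.mul_apply, LinearEquiv.mul_apply, hdS, map_smul, hcS, smul_smul, Pi.mul_apply, permS_mul]

/-- Inverses track along inverses. [folklore] -/
theorem Tracks.inv {Φ : (diagShells A I hA hI).PacketAut} {σ : ∀ j : index.Label, Equiv.Perm (index.Caps j)}
    (hΦ : Tracks Φ σ) : Tracks Φ⁻¹ σ⁻¹ := fun j vQ S => by
  obtain ⟨c, hc, hcS⟩ := hΦ j vQ (permS (σ j)⁻¹ S)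
  rw [← permS_mul, mul_inv_cancel, permS_one] at hcS
  refine ⟨c⁻¹, inv_ne_zero hc, ?_⟩
  show (Φ j vQ).symm (tS A I hA hI vQ S) = c⁻¹ • tS A I hA hI vQ (permS (σ j)⁻¹ S)
  rw [LinearEquiv.symm_apply_eq, map_smul, hcS, smul_smul, inv_mul_cancel₀ hc, one_smul]

/-- An (Ind2)-family tracks along `1` (diagonal Ism only rescales). [claim: Mochizuki2012, status: disputed] -/
theorem tracks_of_mem_Ind2Family (hdI : ∀ v, ∀ g ∈ I v, IsDiag g) {Φ : (diagShells A I hA hI).PacketAut}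
    (hΦ : Φ ∈ (diagShells A I hA hI).Ind2Family) : Tracks Φ 1 := fun j vQ S => by
  obtain ⟨g, hg, hΦj⟩ := hΦ j vQ
  obtain ⟨c, hc, hcS⟩ := diag_rescales_tS A I hA hI vQ g (fun k v => hdI v.1 _ (hg k v)) S
  refine ⟨c, hc, ?_⟩
  rw [hΦj, hcS, Pi.one_apply, permS_one]

/-- An (Ind1)-family tracks along ITS capsule permutations `(σ_j)_j` — one per label, for all places (diagonal strip-automorphisms only
rescale). [claim: Mochizuki2012, status: disputed] -/
theorem tracks_of_mem_Ind1Family (hdA : ∀ v, ∀ g ∈ A v, IsDiag g) {Φ : (diagShells A I hA hI).PacketAut}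
    (hΦ : Φ ∈ (diagShells A I hA hI).Ind1Family) : ∃ σ, Tracks Φ σ := by
  choose σ h hh hΦj using hΦ
  refine ⟨σ, fun j vQ S => ?_⟩
  obtain ⟨c, hc, hcS⟩ := diag_rescales_tS A I hA hI vQ (fun k (v : index.Fibre vQ) => h j k v.1)
    (fun k v => hdA v.1 _ (hh j k v.1)) (permS (σ j) S)
  refine ⟨c, hc, ?_⟩
  rw [show Φ j vQ = _ from hΦj j vQ, LinearEquiv.trans_apply, permute_tS, hcS]

/-- **`exists_tracks_of_mem_closure`**: on diagonal shells EVERY element of `⟨(Ind1) ∪ (Ind2)⟩` tracks the patterns along ONE family of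
capsule permutations `(σ_j)_j` — the same at every place (closure induction). [claim: Mochizuki2012, status: disputed] -/
theorem exists_tracks_of_mem_closure (hdA : ∀ v, ∀ g ∈ A v, IsDiag g) (hdI : ∀ v, ∀ g ∈ I v, IsDiag g)
    {Φ : (diagShells A I hA hI).PacketAut}
    (hΦ : Φ ∈ Subgroup.closure ((diagShells A I hA hI).Ind1Family ∪ (diagShells A I hA hI).Ind2Family)) :
    ∃ σ, Tracks Φ σ := by
  induction hΦ using Subgroup.closure_induction with
  | mem Φ hΦ =>
    rcases hΦ with h1 | h2
    · exact tracks_of_mem_Ind1Family hdA h1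
    · exact ⟨1, tracks_of_mem_Ind2Family hdI h2⟩
  | one => exact ⟨1, tracks_one⟩
  | mul Φ Ψ _ _ ihΦ ihΨ =>
    obtain ⟨σ, hσ⟩ := ihΦ
    obtain ⟨τ, hτ⟩ := ihΨ
    exact ⟨σ * τ, hσ.mul hτ⟩
  | inv Φ _ ih =>
    obtain ⟨σ, hσ⟩ := ih
    exact ⟨σ⁻¹, hσ.inv⟩

end Tracking

/-! ## 3. The place obstruction on diagonal shells -/

section Obstruction

variable (A I : index.V → Set ((Fin 2 → ℚ) ≃ₗ[ℚ] (Fin 2 → ℚ)))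
  (hA : ∀ v, LinearEquiv.refl ℚ _ ∈ A v) (hI : ∀ v, LinearEquiv.refl ℚ _ ∈ I v)

/-- The PLACE WITNESS on diagonal shells: identity at `v_ℚ⁰ = false`, the diagonal swap family at `v_ℚ¹ = true`. [folklore] -/
def placeWitnessD (b : Bool) : (diagShells A I hA hI).PacketAut :=
  bif b then (diagShells A I hA hI).capsPermFamily sw else 1

/-- Each place's family lies in `⟨(Ind1) ∪ (Ind2)⟩` (the swap family is an (Ind1)-family over every signature). [folklore] -/
theorem placeWitnessD_mem (b : Bool) :
    placeWitnessD A I hA hI b ∈ Subgroup.closure ((diagShells A I hA hI).Ind1Family ∪ (diagShells A I hA hI).Ind2Family) := by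
  cases b
  · exact one_mem _
  · exact (diagShells A I hA hI).capsPermFamily_mem_closure sw

/-- At the top label, `σ` fixes the factor `0` iff `σ({0}) = {0}` contains `0`. [folklore] -/
theorem zero_mem_permS_singleton_iff {j : index.Label} (σ : Equiv.Perm (index.Caps j)) :
    (0 : index.Caps j) ∈ permS σ {0} ↔ σ 0 = 0 := by
  rw [mem_permS, Finset.mem_singleton, Equiv.symm_apply_eq]; exact eq_comm

/-- **`not_indPlaceSeparable_diagShells` — PRINT-LIKE (DIAGONAL) INDETERMINACIES DO NOT RESCUE PLACE-SEPARABILITY.** For EVERY choice of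
diagonal strip-automorphisms `A` and diagonal Ism `I` on the carriers `ℚ²` of the two-place index, `⟨(Ind1) ∪ (Ind2)⟩` is not
place-separable: a member tracks `t_{{0}}` along one `σ_{j⋆}` at both places — fixing the factor `0` at `v_ℚ⁰` (identity) and moving it
to `j⋆` at `v_ℚ¹` (swap) at once, which no permutation does. [claim: Mochizuki2012, status: disputed] -/
theorem not_indPlaceSeparable_diagShells (hdA : ∀ v, ∀ g ∈ A v, IsDiag g) (hdI : ∀ v, ∀ g ∈ I v, IsDiag g) :
    ¬ IndPlaceSeparable (diagShells A I hA hI) := fun hsep => by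
  have hmem := hsep (fun vQ => placeWitnessD A I hA hI vQ) (placeWitnessD_mem A I hA hI)
  obtain ⟨σ, hσ⟩ := exists_tracks_of_mem_closure hdA hdI hmem
  -- at `v_ℚ⁰`: the identity tracks `t_{0}` along `σ_{j⋆}` ⇒ `σ_{j⋆}` fixes the factor `0`
  obtain ⟨c, -, hc⟩ := hσ jTop false {0}
  have h0 : tS A I hA hI false ({0} : Finset (index.Caps jTop)) = c • tS A I hA hI false (permS (σ jTop) {0}) := hc
  have hfix : permS (σ jTop) {0} = {0} := eq_of_smul_tS_eq A I hA hI false h0.symm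
  -- at `v_ℚ¹`: the swap tracks `t_{0}` along the same `σ_{j⋆}` ⇒ `sw({0}) = {0}`, i.e. the swap fixes `0` — false
  obtain ⟨d, -, hd⟩ := hσ jTop true {0}
  have h1 : (diagShells A I hA hI).permute jTop true (sw jTop) (tS A I hA hI true ({0} : Finset (index.Caps jTop))) =
      d • tS A I hA hI true (permS (σ jTop) {0}) := hd
  rw [permute_tS, hfix] at h1
  have hsw : ({0} : Finset (index.Caps jTop)) = permS (sw jTop) {0} := eq_of_smul_tS_eq A I hA hI true h1.symm
  have : sw jTop 0 = 0 := (zero_mem_permS_singleton_iff (sw jTop)).1 (hsw ▸ Finset.mem_singleton_self 0)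
  exact sw_jTop_zero_ne this

/-- **Corollary (frozen-print type): Ism = strip-automorphisms = the scalar signs `{±1}`** — not place-separable at two places.
[claim: Mochizuki2012, status: disputed] -/
theorem not_indPlaceSeparable_signShells₂ :
    ¬ IndPlaceSeparable (diagShells (fun _ => {LinearEquiv.refl ℚ _, LinearEquiv.neg ℚ})
      (fun _ => {LinearEquiv.refl ℚ _, LinearEquiv.neg ℚ}) (fun _ => Set.mem_insert _ _) (fun _ => Set.mem_insert _ _)) :=
  not_indPlaceSeparable_diagShells _ _ _ _
    (fun _ g hg => by rcases hg with rfl | rfl <;> [exact isDiag_refl; exact isDiag_neg])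
    (fun _ g hg => by rcases hg with rfl | rfl <;> [exact isDiag_refl; exact isDiag_neg])

/-- **Corollary (rigid type, part 1's case re-derived through the invariant)**: Ism = strip-automorphisms = `{1}`. [folklore] -/
theorem not_indPlaceSeparable_rigid₂ :
    ¬ IndPlaceSeparable (diagShells (fun _ => {LinearEquiv.refl ℚ _}) (fun _ => {LinearEquiv.refl ℚ _})
      (fun _ => rfl) (fun _ => rfl)) :=
  not_indPlaceSeparable_diagShells _ _ _ _ (fun _ g hg => by rw [Set.mem_singleton_iff.1 hg]; exact isDiag_refl)
    (fun _ g hg => by rw [Set.mem_singleton_iff.1 hg]; exact isDiag_refl)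

end Obstruction

end Summit.ABC.IUTFork.Joshi.TwoPlace

end
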